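import Summits.QuantumAdvantage.QuantumAdvantage.Theorems.CodimDialRings

/-!
# CodimDial — part 3/6 «Light» (cell decomp-qadv, seat lens-5, generation 12 rev 2; supports item 30910 `SpreadDial.PureCover3`)

§8 ★ THE BASE `linCoverLight3 : LinCoverLight3` PROVED OUTRIGHT: at logarithmic codimension, rows of weight `≤ (log₂ n)^c` form ONE algebraic test (`ind`, `parPoly`, `rowInd`, `sysInd`, `sysInd_eq_one_iff`, `sysInd_mem_lowDeg`, `light_exponent`, `linSpreadLight3_of_algSpread3`).

Verbatim from the node file `run/shared/lean/pub/decomp-qadv/decomp-qadv-lens-5/g12/CodimDial.lean` (rev 2, sha256 b503e7e59b532c38…;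
record `…/g12/NODE-g12.md`; critic row 74 VERIFIED/CLEARED the split), re-namespaced `…Theses.CodimDial` ↦ `…Theorems.CodimDial`;
imports part 2/6 (`CodimDialRings`); joint check of parts 1–3 = `g12/tree/Parts1to3.check.lean` (farm rc 0 · 0 errors ·
0 warnings · 0 sorries).  The `def … : Prop` declarations are STATEMENTS OF THE NODE (regimes of the dial and the two pieces of the exact split
`PureCover3 ⟺ A ∧ B`), not new cruxes; the pieces to FILE are `FewCover3` / `FewBridge3` (part 6) or equivalently `LinCoverLogMed3` / `MedBridge3` (part 5).
NODE EQUATION: `AdviceFreeQNC0Three ⟸ PolyLoss3 [26123] ∧ AlgCover3 [30909] ∧ A ∧ B`, `PureCover3 (30910) ⟺ A ∧ B` (kernel).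
-/

set_option linter.style.longLine false
set_option linter.dupNamespace false

noncomputable section
open scoped Classical

namespace Summit.QuantumAdvantage.QuantumAdvantage.Theorems.CodimDial

open Finset
open Literature.Computability.QuantumComplexity Literature.Computability.QuantumComplexity.RingHLF
open Literature.Computability.MetaComplexity
open Summit.QuantumAdvantage.AdviceFreeQNC0
open Summit.QuantumAdvantage.QuantumAdvantage.Theses

/-! ## §8  THE BASE (PROVED): light rows at logarithmic codimension are ONE algebraic test -/

section Light
variable {n : ℕ}

/-- the `𝔽₃`-indicator of `[G y = 1]`: `ι_G = 2·G² + 2·G`. -/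
def ind (G : Smolensky.CubeFn (ZMod 3) n) : Smolensky.CubeFn (ZMod 3) n := (2 : ZMod 3) • (G * G) + (2 : ZMod 3) • G

/-- CodimDialLight helper `ind_apply` (decomp-qadv land package; see the module docstring). -/
theorem ind_apply (G : Smolensky.CubeFn (ZMod 3) n) (y : Fin n → Bool) : ind G y = if G y = 1 then 1 else 0 := by
  simp only [ind, Pi.add_apply, Pi.smul_apply, Pi.mul_apply, smul_eq_mul]
  generalize G y = a
  revert a
  decide

/-- CodimDialLight helper `ind_mem_lowDeg` (decomp-qadv land package; see the module docstring). -/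
theorem ind_mem_lowDeg {D : ℕ} {G : Smolensky.CubeFn (ZMod 3) n} (hG : G ∈ Smolensky.lowDeg (ZMod 3) n D) :
    ind G ∈ Smolensky.lowDeg (ZMod 3) n (D + D) :=
  Submodule.add_mem _ (Submodule.smul_mem _ (2 : ZMod 3) (Smolensky.mul_mem_lowDeg_add hG hG))
    (Submodule.smul_mem _ (2 : ZMod 3) (Smolensky.lowDeg_mono (Nat.le_add_right D D) hG))

/-- three finite identities in `𝔽₃` indexed by `𝔽₂` (closed, by `decide`). -/
theorem fin_id₁ : ∀ σ : ZMod 2, ((1 + 1 : ZMod 3) * if σ = 0 then (1 : ZMod 3) else 2) = if 1 + σ = 0 then (1 : ZMod 3) else 2 := by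
  decide
/-- CodimDialLight helper `fin_id₂` (decomp-qadv land package; see the module docstring). -/
theorem fin_id₂ : ∀ σ : ZMod 2, ((2 : ZMod 3) - if σ = 0 then (1 : ZMod 3) else 2) = if σ = 0 then (1 : ZMod 3) else 0 := by
  decide
/-- CodimDialLight helper `fin_id₃` (decomp-qadv land package; see the module docstring). -/
theorem fin_id₃ : ∀ σ : ZMod 2, ((if σ = 0 then (1 : ZMod 3) else 2) - 1) = if σ + 1 = 0 then (1 : ZMod 3) else 0 := by
  decide

/-- the PARITY POLYNOMIAL of a set `S` of bit indices: `∏_{u ∈ S} (1 + ι_{G_u})`, valued in `{1, 2} = {±1}`: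
it is `1` iff `Σ_{u ∈ S} [G_u y = 1]` is even (`2 = -1` in `𝔽₃`). -/
def parPoly {N : ℕ} (G : Fin N → Smolensky.CubeFn (ZMod 3) n) (S : Finset (Fin N)) : Smolensky.CubeFn (ZMod 3) n :=
  ∏ u ∈ S, (1 + ind (G u))

/-- CodimDialLight helper `parPoly_apply` (decomp-qadv land package; see the module docstring). -/
theorem parPoly_apply {N : ℕ} (G : Fin N → Smolensky.CubeFn (ZMod 3) n) (S : Finset (Fin N)) (y : Fin n → Bool) :
    parPoly G S y = if (∑ u ∈ S, bit (G u) y) = 0 then 1 else 2 := by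
  induction S using Finset.induction_on with
  | empty => simp [parPoly]
  | insert a S ha ih =>
    rw [parPoly] at ih ⊢
    rw [Finset.prod_insert ha, Finset.sum_insert ha, Pi.mul_apply, ih, Pi.add_apply, Pi.one_apply, ind_apply]
    generalize (∑ u ∈ S, bit (G u) y) = σ
    by_cases hG : G a y = 1
    · simp only [hG, if_true, bit]
      exact fin_id₁ σ
    · simp only [hG, if_false, bit, add_zero, one_mul, zero_add]

/-- CodimDialLight helper `parPoly_mem_lowDeg` (decomp-qadv land package; see the module docstring). -/
theorem parPoly_mem_lowDeg {N D : ℕ} (G : Fin N → Smolensky.CubeFn (ZMod 3) n)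
    (hG : ∀ u, G u ∈ Smolensky.lowDeg (ZMod 3) n D) (S : Finset (Fin N)) :
    parPoly G S ∈ Smolensky.lowDeg (ZMod 3) n (S.card * (D + D)) :=
  Smolensky.prod_mem_lowDeg_card_mul S _ fun u _ =>
    Submodule.add_mem _ (Smolensky.one_mem_lowDeg _) (ind_mem_lowDeg (hG u))

/-- the support of a row and the defect as a parity over the support. -/
def rowSupp {N : ℕ} (a : Fin N → ZMod 2) : Finset (Fin N) := univ.filter fun u => a u ≠ 0

/-- CodimDialLight helper `defect_eq_sum_supp` (decomp-qadv land package; see the module docstring). -/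
theorem defect_eq_sum_supp {N : ℕ} (G : Fin N → Smolensky.CubeFn (ZMod 3) n) (a : Fin N → ZMod 2) (β : ZMod 2)
    (y : Fin n → Bool) : defect G a β y = (∑ u ∈ rowSupp a, bit (G u) y) + β := by
  unfold defect rowSupp
  congr 1
  rw [Finset.sum_filter]
  refine Finset.sum_congr rfl fun u _ => ?_
  rcases (by decide : ∀ t : ZMod 2, t = 0 ∨ t = 1) (a u) with h | h
  · simp [h]
  · simp [h]

/-- the `{0,1}`-valued INDICATOR POLYNOMIAL of one affine constraint (row `a`, right-hand side `β`). -/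
def rowInd {N : ℕ} (G : Fin N → Smolensky.CubeFn (ZMod 3) n) (a : Fin N → ZMod 2) (β : ZMod 2) :
    Smolensky.CubeFn (ZMod 3) n :=
  if β = 0 then 2 - parPoly G (rowSupp a) else parPoly G (rowSupp a) - 1

/-- CodimDialLight helper `rowInd_apply` (decomp-qadv land package; see the module docstring). -/
theorem rowInd_apply {N : ℕ} (G : Fin N → Smolensky.CubeFn (ZMod 3) n) (a : Fin N → ZMod 2) (β : ZMod 2)
    (y : Fin n → Bool) : rowInd G a β y = if defect G a β y = 0 then 1 else 0 := by
  rw [defect_eq_sum_supp]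
  generalize hσ : (∑ u ∈ rowSupp a, bit (G u) y) = σ
  have hpar : parPoly G (rowSupp a) y = if σ = 0 then 1 else 2 := by rw [parPoly_apply, hσ]
  unfold rowInd
  rcases (by decide : ∀ t : ZMod 2, t = 0 ∨ t = 1) β with hβ | hβ
  · subst hβ
    simp only [if_true, Pi.sub_apply, hpar, add_zero]
    have h2 : (2 : Smolensky.CubeFn (ZMod 3) n) y = 2 := rfl
    rw [h2]
    exact fin_id₂ σ
  · subst hβ
    simp only [one_ne_zero, if_false, Pi.sub_apply, Pi.one_apply, hpar]
    exact fin_id₃ σ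

/-- CodimDialLight helper `rowInd_mem_lowDeg` (decomp-qadv land package; see the module docstring). -/
theorem rowInd_mem_lowDeg {N D W : ℕ} (G : Fin N → Smolensky.CubeFn (ZMod 3) n)
    (hG : ∀ u, G u ∈ Smolensky.lowDeg (ZMod 3) n D) (a : Fin N → ZMod 2) (β : ZMod 2) (hW : rowWeight a ≤ W) :
    rowInd G a β ∈ Smolensky.lowDeg (ZMod 3) n (W * (D + D)) := by
  have hpar : parPoly G (rowSupp a) ∈ Smolensky.lowDeg (ZMod 3) n (W * (D + D)) :=
    Smolensky.lowDeg_mono (Nat.mul_le_mul_right _ hW) (parPoly_mem_lowDeg G hG (rowSupp a))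
  have h2 : (2 : Smolensky.CubeFn (ZMod 3) n) ∈ Smolensky.lowDeg (ZMod 3) n (W * (D + D)) := by
    have : (2 : Smolensky.CubeFn (ZMod 3) n) = (2 : ZMod 3) • (1 : Smolensky.CubeFn (ZMod 3) n) := by
      funext y; simp
    rw [this]
    exact Submodule.smul_mem _ _ (Smolensky.one_mem_lowDeg _)
  unfold rowInd
  split_ifs
  · exact Submodule.sub_mem _ h2 hpar
  · exact Submodule.sub_mem _ hpar (Smolensky.one_mem_lowDeg _)

/-- the INDICATOR POLYNOMIAL of the whole system: the product of the row indicators. -/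
def sysInd {N ℓ : ℕ} (G : Fin N → Smolensky.CubeFn (ZMod 3) n) (A : Fin ℓ → Fin N → ZMod 2) (b : Fin ℓ → ZMod 2) :
    Smolensky.CubeFn (ZMod 3) n :=
  ∏ r, rowInd G (A r) (b r)

/-- a product of `{0,1}`-values in `𝔽₃` is `1` iff every factor is `1`, and is `{0,1}`-valued. -/
theorem prod_boole01 {ι : Type*} (s : Finset ι) (f : ι → ZMod 3) (h : ∀ j ∈ s, f j = 0 ∨ f j = 1) :
    (∏ j ∈ s, f j = 0 ∨ ∏ j ∈ s, f j = 1) ∧ (∏ j ∈ s, f j = 1 ↔ ∀ j ∈ s, f j = 1) := by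
  induction s using Finset.induction_on with
  | empty => simp
  | insert a s ha ih =>
    have h' : ∀ j ∈ s, f j = 0 ∨ f j = 1 := fun j hj => h j (Finset.mem_insert_of_mem hj)
    obtain ⟨ih1, ih2⟩ := ih h'
    rw [Finset.prod_insert ha]
    rcases h a (Finset.mem_insert_self a s) with ha0 | ha1
    · rw [ha0, zero_mul]
      refine ⟨Or.inl rfl, ⟨fun h0 => absurd h0 zero_ne_one, fun hall => ?_⟩⟩
      have := hall a (Finset.mem_insert_self a s); rw [ha0] at this; exact absurd this zero_ne_one
    · rw [ha1, one_mul]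
      refine ⟨ih1, ⟨fun h1 => ?_, fun hall => ih2.mpr fun j hj => hall j (Finset.mem_insert_of_mem hj)⟩⟩
      intro j hj
      rcases Finset.mem_insert.mp hj with rfl | hj'
      · exact ha1
      · exact ih2.mp h1 j hj'

/-- CodimDialLight helper `sysInd_eq_one_iff` (decomp-qadv land package; see the module docstring). -/
theorem sysInd_eq_one_iff {N ℓ : ℕ} (G : Fin N → Smolensky.CubeFn (ZMod 3) n) (A : Fin ℓ → Fin N → ZMod 2)
    (b : Fin ℓ → ZMod 2) (y : Fin n → Bool) : sysInd G A b y = 1 ↔ ∀ r, defect G (A r) (b r) y = 0 := by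
  unfold sysInd
  rw [Finset.prod_apply]
  have h01 : ∀ r ∈ (univ : Finset (Fin ℓ)), rowInd G (A r) (b r) y = 0 ∨ rowInd G (A r) (b r) y = 1 := by
    intro r _; rw [rowInd_apply]; split_ifs <;> simp
  rw [(prod_boole01 _ _ h01).2]
  simp only [Finset.mem_univ, forall_true_left, rowInd_apply]
  refine forall_congr' fun r => ?_
  constructor
  · intro h; by_contra hne; rw [if_neg hne] at h; exact zero_ne_one h
  · intro h; rw [if_pos h]

/-- CodimDialLight helper `sysInd_mem_lowDeg` (decomp-qadv land package; see the module docstring). -/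
theorem sysInd_mem_lowDeg {N ℓ D W : ℕ} (G : Fin N → Smolensky.CubeFn (ZMod 3) n)
    (hG : ∀ u, G u ∈ Smolensky.lowDeg (ZMod 3) n D) (A : Fin ℓ → Fin N → ZMod 2) (b : Fin ℓ → ZMod 2)
    (hW : ∀ r, rowWeight (A r) ≤ W) : sysInd G A b ∈ Smolensky.lowDeg (ZMod 3) n (ℓ * (W * (D + D))) := by
  have h := Smolensky.prod_mem_lowDeg_card_mul (univ : Finset (Fin ℓ)) (fun r => rowInd G (A r) (b r))
    (fun r _ => rowInd_mem_lowDeg G hG (A r) (b r) (hW r))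
  simpa [sysInd, Finset.card_univ, Fintype.card_fin] using h

/-- exponent bookkeeping of the base: with `L = log₂ n ≥ 4C + 4` and `2^ℓ ≤ n^C`:
`ℓ ≤ C(L+1)`, `ℓ·(L^c·(L^c+L^c)) ≤ L^(2c+3)`, `L^c ≤ L^(2c+3)`. [arithmetic] -/
theorem light_exponent {n C c ℓ : ℕ} (hL : 4 * C + 4 ≤ Nat.log 2 n) (hℓ : 2 ^ ℓ ≤ n ^ C) :
    ℓ * ((Nat.log 2 n) ^ c * ((Nat.log 2 n) ^ c + (Nat.log 2 n) ^ c)) ≤ (Nat.log 2 n) ^ (2 * c + 3) ∧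
    (Nat.log 2 n) ^ c ≤ (Nat.log 2 n) ^ (2 * c + 3) := by
  set L := Nat.log 2 n with hLdef
  have h1 : n < 2 ^ (L + 1) := Nat.lt_pow_succ_log_self (by norm_num) n
  have hℓL : ℓ ≤ C * (L + 1) := by
    have : 2 ^ ℓ ≤ 2 ^ (C * (L + 1)) :=
      calc 2 ^ ℓ ≤ n ^ C := hℓ
        _ ≤ (2 ^ (L + 1)) ^ C := Nat.pow_le_pow_left h1.le C
        _ = 2 ^ (C * (L + 1)) := by rw [← pow_mul, mul_comm]
    exact (Nat.pow_le_pow_iff_right (by norm_num)).mp this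
  have hL1 : 1 ≤ L := by omega
  refine ⟨?_, Nat.pow_le_pow_right hL1 (by omega)⟩
  have hkey : ℓ * 2 ≤ L * L * L := by
    calc ℓ * 2 ≤ C * (L + 1) * 2 := Nat.mul_le_mul_right 2 hℓL
      _ ≤ L * L * 1 := by nlinarith
      _ ≤ L * L * L := Nat.mul_le_mul_left _ hL1
  calc ℓ * (L ^ c * (L ^ c + L ^ c)) = ℓ * 2 * (L ^ c * L ^ c) := by ring
    _ ≤ L * L * L * (L ^ c * L ^ c) := Nat.mul_le_mul_right _ hkey
    _ = L ^ (2 * c + 3) := by ring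

/-- **THE BASE THEOREM**: `AlgSpread3 → LinSpreadLight3`.  A system of `ℓ ≤ C(log₂ n + 1)` rows of weight
`≤ (log₂ n)^c` on bits of degree `≤ (log₂ n)^c` is cut out EXACTLY by the `{0,1}`-valued polynomial `sysInd` of degree
`≤ ℓ·2(log₂ n)^(2c) ≤ (log₂ n)^(2c+3)` — an algebraic test, to which `AlgSpread3` (30970) applies verbatim. -/
theorem linSpreadLight3_of_algSpread3 (h : SpreadDial.AlgSpread3) : LinSpreadLight3 := by
  obtain ⟨η, hη, k, hk⟩ := h
  refine ⟨η, hη, k, fun C c => ?_⟩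
  obtain ⟨n₀, hn₀⟩ := hk (2 * c + 3)
  refine ⟨max n₀ (2 ^ (4 * C + 4)), fun n hn P hP N hN G hG ℓ hℓ A b hW hdense => ?_⟩
  have hnn₀ : n₀ ≤ n := le_of_max_le_left hn
  have hnpow : 2 ^ (4 * C + 4) ≤ n := le_of_max_le_right hn
  have hn0 : n ≠ 0 := by have := Nat.one_le_two_pow (n := 4 * C + 4); omega
  have hL : 4 * C + 4 ≤ Nat.log 2 n := Nat.le_log_of_pow_le (by norm_num) hnpow
  obtain ⟨hdeg, hmono⟩ := light_exponent (c := c) hL hℓ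
  -- the test
  have hψ : sysInd G A b ∈ Smolensky.lowDeg (ZMod 3) n ((Nat.log 2 n) ^ (2 * c + 3)) :=
    Smolensky.lowDeg_mono hdeg (sysInd_mem_lowDeg G hG A b hW)
  have hP' : ∀ i, P i ∈ Smolensky.lowDeg (ZMod 3) n ((Nat.log 2 n) ^ (2 * c + 3)) :=
    fun i => Smolensky.lowDeg_mono hmono (hP i)
  have hdense' : (1 - η) * (2 : ℝ) ^ n ≤ ((univ.filter fun y : Fin n → Bool => sysInd G A b y = 1).card : ℝ) := by
    refine le_trans hdense ?_
    exact_mod_cast card_le_card fun y hy => by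
      simp only [linEvent, Finset.mem_filter, Finset.mem_univ, true_and] at hy
      simp only [Finset.mem_filter, Finset.mem_univ, true_and]
      exact (sysInd_eq_one_iff G A b y).mpr hy
  have hmain := hn₀ n hnn₀ P hP' (sysInd G A b) hψ hdense'
  refine le_trans hmain ?_
  exact_mod_cast card_le_card fun y hy => by
    simp only [Finset.mem_filter, Finset.mem_univ, true_and] at hy
    rw [Finset.mem_inter]
    simp only [linEvent, lossSet, Finset.mem_filter, Finset.mem_univ, true_and]
    exact ⟨(sysInd_eq_one_iff G A b y).mp hy.1, hy.2⟩

/-- **the base rung in cover form, PROVED OUTRIGHT**: `LinCoverLight3`. -/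
theorem linCoverLight3 : LinCoverLight3 := fun _ hA => linSpreadLight3_of_algSpread3 hA

/-- and recorded against T: the base is of course also necessary. -/
theorem linSpreadLight3_of_linSpread3 (h : LinSpread3) : LinSpreadLight3 :=
  linSpreadLight3_of_linSpreadLog3 (linSpreadLog3_of_linSpread3 h)

end Light

end Summit.QuantumAdvantage.QuantumAdvantage.Theorems.CodimDial
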